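import Summits.QuantumFields.YangMills.Theorems.BalabanLadderNTReflectionCauchySchwarz
import Literature.MathematicalPhysics.QuantumFieldTheory.WilsonSiteRPForm
import HarnessLib

/-!
# Crux `NT` (stmt-QuantumFields-19353): reflection Cauchy–Schwarz in the POSITIVE-half form of card `rp-linearised-loop-response`

Helper file (`--supports stmt-QuantumFields-19353`) of the fleet lead prover of crux `NT` (unit `ym-spine-19353-p1`,
g3); companion of `…NTReflectionCauchySchwarz` (p480409).  That file states the truncated Schwarz inequality of
odd-torus reflection positivity for observables of the NEGATIVE half `negSideEdges S ∪ sliceZeroEdges` (the tree's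
coordinates).  The crux-ideate card `rp-linearised-loop-response` (seat `ym-cruxidea-19353-1`) types «RPCS» for
observables of the CLOSED NON-NEGATIVE half `0 ≤ t ≤ S` of the torus of side `2S+1` (both endpoints of the link at times
`≤ S`; its `halfEdges`), with the bounded spectator on the `ϑ`-fixed slice `t = 0`.  This file supplies exactly that form:

* `integral_comp_negReflect_odd` — the Wilson measure on the ODD torus is invariant under the site reflection
  `ϑ t = −t` (`∫ F∘ϑ = ∫ F`; the tree had it for even sides only, `wilsonMeasure_map_negReflect`): conjugate `ϑ` to the
  link reflection by the translation `t ↦ t − S` (`negReflect_torusConfigShift`) and use the invariances under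
  translations and under the link reflection;
* `dependsOn_negReflect_of_posHalf` — an observable of the non-negative half, reflected, is an observable of
  `negSideEdges S ∪ sliceZeroEdges`;
* `sq_cov_negReflect_le_odd_pos` — **RPCS, positive-half form**: for bounded measurable real `F, H` of the non-negative
  half, `(∫ F∘ϑ · H − ∫F ∫H)² ≤ (∫ F∘ϑ · F − (∫F)²) · (∫ H∘ϑ · H − (∫H)²)` (`β ≥ 0`, `S ≥ 1`).

Refs: Osterwalder–Seiler 1978 §2; Fröhlich–Israel–Lieb–Simon 1978 Thm 2.1.
-/

set_option autoImplicit false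

noncomputable section

open MeasureTheory Finset
open Literature.MathematicalPhysics.QuantumFieldTheory
open Literature.MathematicalPhysics.QuantumFieldTheory.WilsonRP
open Literature.MathematicalPhysics.QuantumFieldTheory.WilsonSiteRP
open Literature.MathematicalPhysics.QuantumFieldTheory.WilsonNegRP
open Literature.MathematicalPhysics.QuantumFieldTheory.FariaDaVeigaOCarroll2022

namespace Summit.QuantumFields.YangMills.Cruxes.NT.Reflection

section Pos

variable {d L N : ℕ} [NeZero d] [NeZero L]
variable {G : Type*} [Group G] [TopologicalSpace G] [IsTopologicalGroup G] [CompactSpace G]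
  [MeasurableSpace G] [BorelSpace G] (ρ : G →* Matrix (Fin N) (Fin N) ℂ)

/-- **The Wilson measure on the odd torus is invariant under the site reflection `ϑ t = −t`**:
`∫ F∘ϑ dμ_{Λ,β} = ∫ F dμ_{Λ,β}` (side `L = 2S+1`).  Conjugation `ϑ ∘ τ = τ ∘ Θ` by the translation `τ : t ↦ t − S`
(`negReflect_torusConfigShift`), translation invariance (`wilsonExpectation_comp_torusConfigShift`) and invariance under
the link reflection `Θ` (`measurePreserving_timeReflectEquiv`). [cite: OsterwalderSeiler1978, §2] -/
theorem integral_comp_negReflect_odd {S : ℕ} (hL : L = 2 * S + 1) (hρ : Continuous ρ) (β : ℝ)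
    (F : GaugeConfig d L G → ℝ) :
    ∫ U, F U.negReflect ∂(wilsonMeasure ρ β) = ∫ U, F U ∂(wilsonMeasure ρ β) := by
  set τ := torusConfigShift (G := G) (shiftVec (d := d) (L := L) S) with hτ
  have hshift : ∀ Φ : GaugeConfig d L G → ℝ, ∫ U, Φ U ∂(wilsonMeasure ρ β) = ∫ U, Φ (τ U) ∂(wilsonMeasure ρ β) := by
    intro Φ
    have h := wilsonExpectation_comp_torusConfigShift ρ β (shiftVec (d := d) (L := L) S) Φ
    unfold wilsonExpectation at h
    exact h.symm
  rw [hshift (fun U => F U.negReflect), hshift F]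
  have hΘ := (measurePreserving_timeReflectEquiv (d := d) (L := L) (G := G) ρ hρ β).integral_comp
    (timeReflectEquiv (d := d) (L := L) (G := G)).measurableEmbedding (fun U => F (τ U))
  refine Eq.trans (integral_congr_ae (ae_of_all _ fun U => ?_)) hΘ
  simp only [hτ, negReflect_torusConfigShift hL]
  rfl

omit [TopologicalSpace G] [IsTopologicalGroup G] [CompactSpace G] [MeasurableSpace G] [BorelSpace G] in
/-- **The reflection carries the non-negative half into the tree's negative blocks.**  If `F` depends only on the links
with both endpoints at times `≤ S` (side `L = 2S+1`, `S ≥ 1`), then `F∘ϑ` depends only on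
`negSideEdges S ∪ sliceZeroEdges`: a temporal link `t → t+1` (`t ≤ S−1`) reflects to the link based at time `2S − t ≥ S+1`,
a spatial link at time `t` to one at time `0` (`t = 0`) or `2S+1−t ≥ S+1` (`1 ≤ t ≤ S`). [folklore] -/
theorem dependsOn_negReflect_of_posHalf {S : ℕ} (hL : L = 2 * S + 1) (hS : 1 ≤ S) {α : Type*}
    {F : GaugeConfig d L G → α}
    (hF : DependsOn F {e : Edge d L | (e.1 0).val ≤ S ∧ ((e.1.shift e.2) 0).val ≤ S}) :
    DependsOn (fun U : GaugeConfig d L G => F U.negReflect)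
      ((negSideEdges S ∪ sliceZeroEdges : Finset (Edge d L)) : Set (Edge d L)) := by
  haveI : Fact (1 < L) := ⟨by omega⟩
  intro U V hUV
  refine hF fun e he => ?_
  obtain ⟨he1, he2⟩ := he
  have hmem : siteEdgeReflect e ∈ ((negSideEdges S ∪ sliceZeroEdges : Finset (Edge d L)) : Set (Edge d L)) := by
    rw [mem_coe]
    simp only [mem_union, negSideEdges, sliceZeroEdges, mem_filter, mem_univ, true_and]
    obtain ⟨x, i⟩ := e
    by_cases hi : i = 0
    · subst hi
      left
      simp only [siteEdgeReflect, ↓reduceIte]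
      simp only at he1 he2
      have hlt : (x 0).val + 1 < L := by omega
      have hval : ((x.shift 0) 0).val = (x 0).val + 1 := by
        rw [shift_apply_self, ZMod.val_add, ZMod.val_one, Nat.mod_eq_of_lt hlt]
      rw [hval] at he2
      rw [val_negReflect_shift_zero, if_neg (by omega)]
      omega
    · simp only [siteEdgeReflect, if_neg hi]
      rw [val_negReflect]
      simp only at he1
      by_cases h0 : (x 0).val = 0
      · right; exact ⟨hi, by rw [if_pos h0]⟩
      · left; rw [if_neg h0]; omega
  rw [negReflect_apply, negReflect_apply]
  split_ifs with h0
  · rw [hUV _ hmem]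
  · exact hUV _ hmem

/-- **RPCS, positive-half form (the typed first lemma of card `rp-linearised-loop-response`).**  On the torus of side
`L = 2S+1` (`S ≥ 1`, `β ≥ 0`), for bounded measurable real observables `F, H` depending only on the links of the closed
non-negative half (both endpoints at times `≤ S`):
`(∫ F∘ϑ · H − ∫F ∫H)² ≤ (∫ F∘ϑ · F − (∫F)²) · (∫ H∘ϑ · H − (∫H)²)`, `ϑ = GaugeConfig.negReflect`.
(Apply `sq_cov_negReflect_le_odd` to `F∘ϑ`, `H∘ϑ`, which live on the negative blocks, and undo the reflection by
`ϑ∘ϑ = id` and `integral_comp_negReflect_odd`.)  For `F` on the spatial links of the slice `t = 0` one has `F∘ϑ = F`,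
so the left side is `Cov(F, H)²` and the first factor is `Var F`. [cite: FrohlichIsraelLiebSimon1978, Thm. 2.1] -/
theorem sq_cov_negReflect_le_odd_pos {S : ℕ} (hL : L = 2 * S + 1) (hS : 1 ≤ S) (hρ : Continuous ρ) {β : ℝ}
    (hβ : 0 ≤ β) {F H : GaugeConfig d L G → ℝ} (hFm : Measurable F) (hHm : Measurable H)
    (hFb : ∃ K : ℝ, ∀ U, |F U| ≤ K) (hHb : ∃ K : ℝ, ∀ U, |H U| ≤ K)
    (hFdep : DependsOn F {e : Edge d L | (e.1 0).val ≤ S ∧ ((e.1.shift e.2) 0).val ≤ S})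
    (hHdep : DependsOn H {e : Edge d L | (e.1 0).val ≤ S ∧ ((e.1.shift e.2) 0).val ≤ S}) :
    (∫ U, F U.negReflect * H U ∂(wilsonMeasure ρ β) -
        (∫ U, F U ∂(wilsonMeasure ρ β)) * (∫ U, H U ∂(wilsonMeasure ρ β))) ^ 2 ≤
      (∫ U, F U.negReflect * F U ∂(wilsonMeasure ρ β) - (∫ U, F U ∂(wilsonMeasure ρ β)) ^ 2) *
        (∫ U, H U.negReflect * H U ∂(wilsonMeasure ρ β) - (∫ U, H U ∂(wilsonMeasure ρ β)) ^ 2) := by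
  have hϑm : Measurable (GaugeConfig.negReflect : GaugeConfig d L G → GaugeConfig d L G) := measurable_negReflect
  have key := sq_cov_negReflect_le_odd ρ hL hS hρ hβ (A := fun U => F U.negReflect) (B := fun U => H U.negReflect)
    (hFm.comp hϑm) (hHm.comp hϑm) (hFb.imp fun K hK U => hK _) (hHb.imp fun K hK U => hK _)
    (dependsOn_negReflect_of_posHalf hL hS hFdep) (dependsOn_negReflect_of_posHalf hL hS hHdep)
  simp only [negReflect_negReflect_config] at key
  rw [integral_comp_negReflect_odd ρ hL hρ β F, integral_comp_negReflect_odd ρ hL hρ β H] at key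
  exact key

end Pos

end Summit.QuantumFields.YangMills.Cruxes.NT.Reflection

end
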